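import Mathlib.GroupTheory.Complement
import Summits.MatrixMultiplication.OmegaCensus.BoxNotUsefulLift

/-!
# ω-census, family (b3): conjecture C9 — the KEY-LIFT lemma (independent key patterns over a subgroup lift along a transversal)

HONEST FRAMING (pub-omega census; verbatim): lottery ticket; floor = certified bounds/negative ranges.
Census BOOKKEEPING (conjecture C9 of the cell, STRUCTURE.md §2; pub-omega kernel-l4 gen 16, task K-5 = the non-nilpotent
side).  This file states ONCE the mechanism behind every uniform `¬ BoxUseful` theorem of the cell so far (stpp-1's
`CentreIndexFourLower`, the Γ-reduction of `MetacyclicBoxPattern`, kernel-l4 g15's five `CommPairs.*` theorems): a box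
`G × Y × W`, a subgroup `N ≤ G` and a *pattern* `T` of triples `(n, y, w)` (`n ∈ N`, `y ∈ Y`, `w ∈ W`).

* The *gauge word* of two columns `c = (y, w)`, `c' = (y', w')` is `g(c,c') = (y w)(w' w⁻¹)(y' y⁻¹)(y' w')⁻¹` (`gaugeWord`);
  it always lies in the derived subgroup of `⟨Y ∪ W⟩`.  The *base cell* of `t = (n, y, w)` is `(w⁻¹ y⁻¹ n, y, w)` and its
  *lift* by `k ∈ G` is `(w⁻¹ y⁻¹ n k, y, w)` (`baseCell`, `liftCell`).
* **Key-lift lemma (`exists_indep`).** If `N` contains every `n` and every gauge word of the pattern, and the base cells of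
  distinct pattern triples never have trivial cell word (i.e. `T` is independent in the KEY GRAPH on `N × (Y × W)`:
  `(n,c) ~ (n',c')` iff `n = g(c,c') n'` or `n' = g(c',c) n`), then for a right transversal `K` of `N` the `|T|·[G:N]`
  lifted cells are independent: the word of `(w⁻¹y⁻¹nk, y, w)` and `(w'⁻¹y'⁻¹n'k', y', w')` is trivial only if
  `k k'⁻¹ = n⁻¹ g(c,c') n' ∈ N`, forcing `k = k'`, and then it is the word of the two base cells.
* **Corollary (`not_boxUseful`).** `#Y = #W = 3` and `9·|N| ≤ 5·|T|` ⇒ `G` is not box-useful.  So every uniform theorem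
  reduces to: relations ⇒ gauge words in a small explicit `N`, plus a pattern found by machine (key-graph MIS) and checked by
  `|T|²` word normal forms.  `subgroupOfFinset` builds the small `N` from an explicit multiplication-closed finset.
Nothing here is progress on `ω`.
-/

namespace Summit.MatrixMultiplication.OmegaCensus

open Finset ProductBoxBound

namespace KeyLift

variable {G : Type*} [Group G]

/-- The gauge word `g(c,c') = (y w)(w' w⁻¹)(y' y⁻¹)(y' w')⁻¹` of the columns `c = (y, w)`, `c' = (y', w')`. [folklore] -/
def gaugeWord (y w y' w' : G) : G := y * w * (w' * w⁻¹) * (y' * y⁻¹) * (y' * w')⁻¹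

/-- The base cell `(w⁻¹ y⁻¹ n, y, w)` of a pattern triple `t = (n, y, w)`. [folklore] -/
def baseCell (t : G × G × G) : G × G × G := (t.2.2⁻¹ * t.2.1⁻¹ * t.1, t.2.1, t.2.2)

/-- The lifted cell `(w⁻¹ y⁻¹ n k, y, w)` of a pattern triple `t = (n, y, w)` over `k`. [folklore] -/
def liftCell (t : G × G × G) (k : G) : G × G × G := (t.2.2⁻¹ * t.2.1⁻¹ * t.1 * k, t.2.1, t.2.2)

/-- The cell word of two lifted cells, solved for `k k'⁻¹`: it is trivial iff `k k'⁻¹ = n⁻¹ · g(c,c') · n'`. [folklore] -/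
theorem cellWord_liftCell_eq_one_iff (t t' : G × G × G) (k k' : G) :
    cellWord (liftCell t k) (liftCell t' k') = 1 ↔
      k * k'⁻¹ = t.1⁻¹ * gaugeWord t.2.1 t.2.2 t'.2.1 t'.2.2 * t'.1 := by
  obtain ⟨n, y, w⟩ := t
  obtain ⟨n', y', w'⟩ := t'
  simp only [cellWord, liftCell, gaugeWord]
  constructor
  · intro h
    calc k * k'⁻¹ = (w⁻¹ * y⁻¹ * n)⁻¹ * (w⁻¹ * y⁻¹ * n * k * (w'⁻¹ * y'⁻¹ * n' * k')⁻¹ * (y * y'⁻¹) * (w * w'⁻¹)) *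
          ((w'⁻¹ * y'⁻¹ * n')⁻¹ * (y * y'⁻¹) * (w * w'⁻¹))⁻¹ := by group
      _ = n⁻¹ * (y * w * (w' * w⁻¹) * (y' * y⁻¹) * (y' * w')⁻¹) * n' := by rw [h]; group
  · intro h
    calc w⁻¹ * y⁻¹ * n * k * (w'⁻¹ * y'⁻¹ * n' * k')⁻¹ * (y * y'⁻¹) * (w * w'⁻¹)
          = w⁻¹ * y⁻¹ * n * (k * k'⁻¹) * n'⁻¹ * y' * w' * (y * y'⁻¹) * (w * w'⁻¹) := by group
      _ = 1 := by rw [h]; group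

/-- Two lifted cells over the SAME transversal element have the cell word of their base cells. [folklore] -/
theorem cellWord_liftCell_same (t t' : G × G × G) (k : G) :
    cellWord (liftCell t k) (liftCell t' k) = cellWord (baseCell t) (baseCell t') := by
  obtain ⟨n, y, w⟩ := t
  obtain ⟨n', y', w'⟩ := t'
  simp only [cellWord, liftCell, baseCell]
  group

/-- A lifted cell remembers its column. [folklore] -/
theorem liftCell_snd (t : G × G × G) (k : G) : (liftCell t k).2 = t.2 := rfl

/-- **KEY-LIFT LEMMA.** An independent key pattern `T ⊆ N × Y × W` (all `n` and all gauge words in `N`, base cells of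
distinct triples never interacting) lifts along a right transversal of `N` to an independent cell set of the box
`G × Y × W` with `#T · [G : N]` cells. [folklore] -/
theorem exists_indep [Fintype G] [DecidableEq G] (N : Subgroup G) {Y W : Finset G} {T : Finset (G × G × G)}
    (hT : T ⊆ univ ×ˢ (Y ×ˢ W)) (hTN : ∀ t ∈ T, t.1 ∈ N)
    (hgauge : ∀ t ∈ T, ∀ t' ∈ T, gaugeWord t.2.1 t.2.2 t'.2.1 t'.2.2 ∈ N)
    (hkey : ∀ t ∈ T, ∀ t' ∈ T, t ≠ t' → cellWord (baseCell t) (baseCell t') ≠ 1) :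
    ∃ J : Finset (G × G × G), J ⊆ univ ×ˢ (Y ×ˢ W) ∧
      (∀ P ∈ J, ∀ P' ∈ J, P ≠ P' → cellWord P P' ≠ 1) ∧ #J = #T * N.index := by
  classical
  -- a right transversal `K` of `N`
  obtain ⟨R, hR, -⟩ := N.exists_isComplement_right 1
  have hRfin : R.Finite := Set.toFinite R
  set K : Finset G := hRfin.toFinset with hKdef
  have memK : ∀ r, r ∈ K ↔ r ∈ R := fun r => Set.Finite.mem_toFinset hRfin
  have cardK : #K = N.index := by
    rw [hKdef, ← hR.ncard_right, Set.ncard_eq_toFinset_card R hRfin]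
  have uniq : ∀ (m₁ m₂ k₁ k₂ : G), m₁ ∈ N → m₂ ∈ N → k₁ ∈ K → k₂ ∈ K →
      m₁ * k₁ = m₂ * k₂ → m₁ = m₂ ∧ k₁ = k₂ := by
    intro m₁ m₂ k₁ k₂ hm₁ hm₂ hk₁ hk₂ heq
    have := @hR.1 (⟨m₁, hm₁⟩, ⟨k₁, (memK k₁).1 hk₁⟩) (⟨m₂, hm₂⟩, ⟨k₂, (memK k₂).1 hk₂⟩) (by simpa using heq)
    simp only [Prod.mk.injEq, Subtype.mk.injEq] at this
    exact this
  -- the lifted cells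
  let lift : (G × G × G) × G → G × G × G := fun p => liftCell p.1 p.2
  have lift_inj : Set.InjOn lift ↑(T ×ˢ K) := by
    rintro ⟨t, k⟩ htk ⟨t', k'⟩ htk' heq
    simp only [Finset.coe_product, Set.mem_prod, Finset.mem_coe] at htk htk'
    obtain ⟨n, y, w⟩ := t
    obtain ⟨n', y', w'⟩ := t'
    simp only [lift, liftCell, Prod.mk.injEq] at heq
    obtain ⟨h1, rfl, rfl⟩ := heq
    have h2 : n * k = n' * k' := by
      have := congrArg (fun x => y * (w * x)) h1
      simpa [mul_assoc] using this
    obtain ⟨rfl, rfl⟩ := uniq n n' k k' (hTN _ htk.1) (hTN _ htk'.1) htk.2 htk'.2 h2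
    rfl
  set J : Finset (G × G × G) := (T ×ˢ K).image lift with hJ
  refine ⟨J, ?_, ?_, ?_⟩
  · intro P hP
    obtain ⟨⟨t, k⟩, htk, rfl⟩ := Finset.mem_image.1 hP
    rw [Finset.mem_product] at htk
    have ht := hT htk.1
    simp only [Finset.mem_product, Finset.mem_univ, true_and] at ht ⊢
    exact ht
  · intro P hP P' hP' hne hw
    obtain ⟨⟨t, k⟩, htk, rfl⟩ := Finset.mem_image.1 hP
    obtain ⟨⟨t', k'⟩, htk', rfl⟩ := Finset.mem_image.1 hP'
    rw [Finset.mem_product] at htk htk'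
    change cellWord (liftCell t k) (liftCell t' k') = 1 at hw
    -- `k k'⁻¹ ∈ N`, hence `k = k'`
    have hkk : k * k'⁻¹ = t.1⁻¹ * gaugeWord t.2.1 t.2.2 t'.2.1 t'.2.2 * t'.1 :=
      (cellWord_liftCell_eq_one_iff t t' k k').1 hw
    have hmem : k * k'⁻¹ ∈ N :=
      hkk ▸ N.mul_mem (N.mul_mem (N.inv_mem (hTN t htk.1)) (hgauge t htk.1 t' htk'.1)) (hTN t' htk'.1)
    have hk : k = k' := by
      have e : (k * k'⁻¹) * k' = 1 * k := by group
      exact ((uniq _ _ _ _ hmem N.one_mem htk'.2 htk.2 e).2).symm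
    subst hk
    rw [cellWord_liftCell_same] at hw
    by_cases htt : t = t'
    · subst htt; exact hne rfl
    · exact hkey t htk.1 t' htk'.1 htt hw
  · rw [hJ, Finset.card_image_of_injOn lift_inj, Finset.card_product, cardK]

/-- **Key-lift criterion for box-uselessness.** With `#Y = #W = 3`, an independent key pattern `T` over `N` with
`9·|N| ≤ 5·|T|` makes `G` not box-useful. [folklore] -/
theorem not_boxUseful [Fintype G] [DecidableEq G] (N : Subgroup G) {Y W : Finset G} (hY : #Y = 3) (hW : #W = 3)
    {T : Finset (G × G × G)} (hT : T ⊆ univ ×ˢ (Y ×ˢ W)) (hTN : ∀ t ∈ T, t.1 ∈ N)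
    (hgauge : ∀ t ∈ T, ∀ t' ∈ T, gaugeWord t.2.1 t.2.2 t'.2.1 t'.2.2 ∈ N)
    (hkey : ∀ t ∈ T, ∀ t' ∈ T, t ≠ t' → cellWord (baseCell t) (baseCell t') ≠ 1)
    (hbig : 9 * Nat.card N ≤ 5 * #T) : ¬ BoxUseful G := by
  obtain ⟨J, hJ, hind, hcard⟩ := exists_indep N hT hTN hgauge hkey
  refine not_boxUseful_of_indep hY hW hJ hind ?_
  have hNG : Nat.card N * N.index = Fintype.card G := by rw [N.card_mul_index, Nat.card_eq_fintype_card]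
  have hidx : 0 < N.index := Nat.pos_of_ne_zero (Subgroup.index_ne_zero_of_finite)
  calc 9 * Fintype.card G = 9 * Nat.card N * N.index := by rw [← hNG, mul_assoc]
    _ ≤ 5 * #T * N.index := Nat.mul_le_mul_right _ hbig
    _ = 5 * #J := by rw [hcard, mul_assoc]

/-! ### Small explicit subgroups -/

/-- A finset containing `1` and closed under products and inverses is (the carrier of) a subgroup. [folklore] -/
def subgroupOfFinset (S : Finset G) (h1 : (1 : G) ∈ S) (hmul : ∀ a ∈ S, ∀ b ∈ S, a * b ∈ S)
    (hinv : ∀ a ∈ S, a⁻¹ ∈ S) : Subgroup G where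
  carrier := ↑S
  one_mem' := by simpa using h1
  mul_mem' := by
    intro a b ha hb
    exact Finset.mem_coe.2 (hmul a (Finset.mem_coe.1 ha) b (Finset.mem_coe.1 hb))
  inv_mem' := by
    intro a ha
    exact Finset.mem_coe.2 (hinv a (Finset.mem_coe.1 ha))

/-- Membership in `subgroupOfFinset S …` is membership in `S`. [folklore] -/
@[simp] theorem mem_subgroupOfFinset {S : Finset G} {h1 : (1 : G) ∈ S} {hmul : ∀ a ∈ S, ∀ b ∈ S, a * b ∈ S}
    {hinv : ∀ a ∈ S, a⁻¹ ∈ S} {x : G} : x ∈ subgroupOfFinset S h1 hmul hinv ↔ x ∈ S := by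
  change x ∈ (↑S : Set G) ↔ x ∈ S
  exact Finset.mem_coe

/-- `|subgroupOfFinset S …| = #S`. [folklore] -/
theorem card_subgroupOfFinset {S : Finset G} {h1 : (1 : G) ∈ S} {hmul : ∀ a ∈ S, ∀ b ∈ S, a * b ∈ S}
    {hinv : ∀ a ∈ S, a⁻¹ ∈ S} : Nat.card (subgroupOfFinset S h1 hmul hinv) = #S := by
  change Nat.card (↑S : Set G) = #S
  rw [Nat.card_eq_card_toFinset]; simp

end KeyLift

end Summit.MatrixMultiplication.OmegaCensus
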